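import Summits.BirchSwinnertonDyer.BirchSwinnertonDyer.Theorems.ErratumRoadFiveRegCertKernelFiveDepthOneO2
import Summits.BirchSwinnertonDyer.BirchSwinnertonDyer.Theorems.ErratumRoadFiveRegCertKernelFiveLogEval
import HarnessLib

/-!
# Route `ErratumRoadFive` (rung K2, `p ≥ 5`), crux `RamNoErratumDataAtFive` (item stmt-BirchSwinnertonDyer-19624, REST‴):
# the GENERIC first-order REG5CERT kernel checker at a SPLIT multiplicative `5`, depth one — the VALUES of the formula-(4.1)
# height `T₁` and of the correction term `T₂ = log_Ê(z)²/(C²·log₅ q_E)` to one digit, and `RegMult.CertSplit W 5 Q 1`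
# (cell `bsd-stepL`, OWNER seat `bsd-stepL-rest-p2` g7; `--supports stmt-BirchSwinnertonDyer-19624`)

HONEST FRAMING: BSD is not proved by any of this; nothing here closes the crux; Schneider's non-degeneracy conjecture (barrier
`Literature.Barriers.BirchSwinnertonDyer.PAdicHeightNondegeneracy`) is asserted NOWHERE; every application is ONE curve. At a SPLIT
multiplicative prime the bundled predicate `ClassClosure.RegulatorNonvanishingAt W 5` has a second half, the Stein–Wuthrich §4.2 MODIFIED
height `heightSplitCoord = heightFourOneCoord − logUnitParamSq/log₅ q_E` at THE Tate parameter (`RegMult.CertSplit`); reg3-eng's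
`…RegCertRung5190r1{,Tate,Split}` did this for one curve at depth two. Generic form at depth ONE (`Q = (a/e², b/e³)`, `e = 5e'`), first
order, for curves with `25 ∣ Δ` (`v₅(q_E) = v₅(Δ) = δ ≥ 2`) and `v₅(log₅ q_E) = 1` (the generic case; `log₅ q_E ≡ 4⁻¹(u₀⁴ − 1)`,
`u₀ = Δ'/c₄³` the unit part of `1/j`): with the depth-one residue `λ` (`log_Ê(z) ≡ 5λ`), `Γ ≡ −c₄/c₆ ≡ C²`, and digits `τ₁, μ, τ₂`
(`T₁ ≡ 5τ₁`: `25 ∣ (λ⁸ − e'⁸) + 20e'⁸τ₁`; `log₅ q_E ≡ 5μ`: `25 ∣ (Δ'⁴ − c₄¹²) − 20c₄¹²μ`; `T₂ ≡ 5τ₂`: `5 ∣ Γμτ₂ − λ²`), the modified height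
is `5(τ₁ − τ₂) + O(5⁻²)`, non-zero as soon as **`5 ∤ τ₁ − τ₂`**. Used at the two SPLIT members D0, D3 of branch (D) of crux 19624 and
usable verbatim on the (T) branch (19702: every (T) pair is split at `p` with `5 ∣ v₅(Δ)`). Theorems only (0 defs, 0 facts); route-free.

* §1 the depth-one first-order data (`‖L‖`, `‖L² − 25λ²‖`, `‖C²σ² − 25λ²‖`, `den x`) — the internals of `heightFourOneCoord_ne_zero_of_certDepthOne`;
* §2 `norm_heightFourOneCoord_sub_le_depthOne` (`‖T₁ − 5τ₁‖ ≤ 5⁻²`); §3 `norm_padicLog_tateParam_sub_le_of_congr` (`‖log₅ q_E − 5μ‖ ≤ 5⁻²`);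
  §4 `norm_correction_sub_le_depthOne` (`‖T₂ − 5τ₂‖ ≤ 5⁻²`); §5 `heightSplitCoord_ne_zero_of_certDepthOne`, `certSplit_of_certDepthOne`,
  `regulatorNonvanishingAt_of_certs_of_GZK`.

References: [SteinWuthrich2013] §4.2 (p. 16); [SilvermanATAEC1994] V.3.1, Lemma V.5.1; [Iwasawa1972PadicL] §4.4; [MazurSteinTate2006] §1;
[KolyvaginEulerSystems1990] Thm. A (GZK).
-/

open scoped Classical

open Filter Topology PowerSeries IsUltrametricDist WeierstrassCurve Literature.NumberTheory.EllipticCurves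
  Literature.NumberTheory.EllipticCurves.Rank1Residual
  Literature.NumberTheory.EllipticCurves.SteinWuthrich2013
  Summit.BirchSwinnertonDyer.Rank1Residual
  Summit.BirchSwinnertonDyer.Rank1Residual.X11b

namespace Summit.BirchSwinnertonDyer.Rank1Residual.X11b.RegMult.KernelCertFive

/-! ### §0 Plumbing in `ℚ₅` -/

/-- Ultrametric inequality for differences. [folklore] -/
private theorem norm_sub_le_max₄ (a b : ℚ_[5]) : ‖a - b‖ ≤ max ‖a‖ ‖b‖ := by
  rw [sub_eq_add_neg, ← norm_neg b]; exact IsUltrametricDist.norm_add_le_max a (-b)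

/-- `‖5^k‖₅ = 1/5^k`. [folklore] -/
private theorem norm_five_pow₄ (k : ℕ) : ‖(5 : ℚ_[5]) ^ k‖ = 1 / (5 : ℝ) ^ k := by
  rw [norm_pow, show (5 : ℚ_[5]) = ((5 : ℕ) : ℚ_[5]) by norm_cast, Padic.norm_p]; simp

/-- `‖5‖₅ = 5⁻¹`. [folklore] -/
private theorem norm_five₄ : ‖(5 : ℚ_[5])‖ = 1 / 5 := by
  rw [show (5 : ℚ_[5]) = (5 : ℚ_[5]) ^ 1 by norm_num, norm_five_pow₄]; norm_num

/-- `‖25‖₅ = 5⁻²`. [folklore] -/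
private theorem norm_twentyfive₄ : ‖(25 : ℚ_[5])‖ = 1 / 25 := by
  rw [show (25 : ℚ_[5]) = (5 : ℚ_[5]) ^ 2 by norm_num, norm_five_pow₄]; norm_num

/-- `‖(4 : ℚ₅)⁻¹‖ = 1`. [folklore] -/
private theorem norm_inv_four₄ : ‖(4 : ℚ_[5])⁻¹‖ = 1 := by
  rw [norm_inv, show (4 : ℚ_[5]) = ((4 : ℤ) : ℚ_[5]) by norm_cast, norm_intCast_eq_one_of_not_dvd (by decide), inv_one]

/-- Fourth powers of elements of norm `≤ 1` are `1`-Lipschitz: `‖u⁴ − v⁴‖ ≤ ‖u − v‖`. [folklore] -/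
private theorem norm_pow_four_sub_le₄ {u v : ℚ_[5]} (hu : ‖u‖ ≤ 1) (hv : ‖v‖ ≤ 1) : ‖u ^ 4 - v ^ 4‖ ≤ ‖u - v‖ := by
  have hid : u ^ 4 - v ^ 4 = (u - v) * ((u + v) * (u ^ 2 + v ^ 2)) := by ring
  rw [hid, norm_mul, norm_mul]
  have h1 : ‖u + v‖ ≤ 1 := (IsUltrametricDist.norm_add_le_max _ _).trans (max_le hu hv)
  have h2 : ‖u ^ 2 + v ^ 2‖ ≤ 1 := by
    refine (IsUltrametricDist.norm_add_le_max _ _).trans (max_le ?_ ?_)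
    · rw [norm_pow]; exact pow_le_one₀ (norm_nonneg _) hu
    · rw [norm_pow]; exact pow_le_one₀ (norm_nonneg _) hv
  calc ‖u - v‖ * (‖u + v‖ * ‖u ^ 2 + v ^ 2‖) ≤ ‖u - v‖ * (1 * 1) := by gcongr
    _ = ‖u - v‖ := by ring

/-- `x = a/e²` in lowest terms has `den x = e²`. [folklore] -/
private theorem den_eq_sq₄ {a : ℤ} {e : ℕ} (he : e ≠ 0) (hcop : Nat.Coprime a.natAbs e) {x : ℚ}
    (hx : x = a / (e : ℚ) ^ 2) : x.den = e ^ 2 := by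
  have hpos : (0 : ℤ) < ((e : ℕ) : ℤ) ^ 2 := by positivity
  have hcop2 : Nat.Coprime a.natAbs ((((e : ℕ) : ℤ) ^ 2).natAbs) := by
    rw [Int.natAbs_pow, Int.natAbs_natCast]; exact hcop.pow_right 2
  have h := Rat.den_div_eq_of_coprime hpos hcop2
  have hx' : x = ((a : ℤ) : ℚ) / ((((e : ℕ) : ℤ) ^ 2 : ℤ) : ℚ) := by rw [hx]; push_cast; ring
  rw [← hx'] at h
  exact_mod_cast h

/-- `gcd(a, 5e') = 1 ⇒ 5 ∤ a`. [folklore] -/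
private theorem not_five_dvd_of_coprime₄ {a : ℤ} {e' : ℕ} (hcop : Nat.Coprime a.natAbs (5 * e')) : ¬ (5 : ℤ) ∣ a := by
  intro h
  have h1 : 5 ∣ a.natAbs := Int.natCast_dvd.mp h
  have h2 : 5 ∣ Nat.gcd a.natAbs (5 * e') := Nat.dvd_gcd h1 (dvd_mul_right 5 e')
  rw [hcop] at h2
  exact absurd (Nat.le_of_dvd one_pos h2) (by norm_num)

/-! ### §1 The depth-one first-order data of a certificate point -/

section Data

variable (W : WeierstrassCurve ℚ) {a₁ a₂ a₃ a₄ a₆ : ℤ} (hW : W = ⟨a₁, a₂, a₃, a₄, a₆⟩)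
include hW

/-- **The first-order data at depth one** (the internals of `heightFourOneCoord_ne_zero_of_certDepthOne`): with `L = log_Ŵ(z(Q))`,
`C² = uniformisationScaleSq`, `σ² = tateSigmaSq q (ch w)`: `‖L‖₅ = 5⁻¹`, `‖L² − 25λ²‖₅ ≤ 5⁻⁴`, `‖C²‖₅ = 1`, `‖C²σ² − 25λ²‖₅ ≤ 5⁻⁴`,
`den x = 25e'²`. [cite: SteinWuthrich2013, §4.2] [cite: SilvermanAEC2009, IV.6.4] -/
theorem firstOrderData_depthOne [W.IsGloballyMinimal] {a b c4 c6 lam : ℤ} {e' : ℕ}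
    (hc4 : c4 = (a₁ ^ 2 + 4 * a₂) ^ 2 - 24 * (2 * a₄ + a₁ * a₃))
    (hc6 : c6 = -(a₁ ^ 2 + 4 * a₂) ^ 3 + 36 * (a₁ ^ 2 + 4 * a₂) * (2 * a₄ + a₁ * a₃) - 216 * (a₃ ^ 2 + 4 * a₆))
    (h5c4 : ¬ (5 : ℤ) ∣ c4) (h5c6 : ¬ (5 : ℤ) ∣ c6) (h5e : ¬ (5 : ℤ) ∣ e') (h5b : ¬ (5 : ℤ) ∣ b)
    (hcop : Nat.Coprime a.natAbs (5 * e'))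
    {x y : ℚ} (hx : x = a / ((5 * e' : ℕ) : ℚ) ^ 2) (hy : y = b / ((5 * e' : ℕ) : ℚ) ^ 3)
    (hlam : (25 : ℤ) ∣ -2 * a * e' * b + 5 * a₁ * a ^ 2 * e' ^ 2 - 2 * lam * b ^ 2) (h5lam : ¬ (5 : ℤ) ∣ lam)
    {q : ℚ_[5]} (hq : ‖q‖ < 1) :
    ‖(W.baseChange ℚ_[5]).padicFormalLog (-(x : ℚ_[5]) / y)‖ = 1 / 5 ∧
      ‖(W.baseChange ℚ_[5]).padicFormalLog (-(x : ℚ_[5]) / y) ^ 2 - 25 * (lam : ℚ_[5]) ^ 2‖ ≤ 1 / 5 ^ 4 ∧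
      ‖uniformisationScaleSq W 5 q‖ = 1 ∧
      ‖uniformisationScaleSq W 5 q * tateSigmaSq q (coshOfSq (logUnitParamSq W 5 q x y)) - 25 * (lam : ℚ_[5]) ^ 2‖
        ≤ 1 / 5 ^ 4 ∧
      x.den = (5 * e') ^ 2 := by
  have h5a : ¬ (5 : ℤ) ∣ a := not_five_dvd_of_coprime₄ hcop
  have he'0 : e' ≠ 0 := by rintro rfl; exact h5e (by simp)
  set V := W.baseChange ℚ_[5] with hV
  have ha1 : V.a₁ = a₁ := baseChange_a₁_eq W hW
  set z : ℚ_[5] := -(x : ℚ_[5]) / y with hz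
  have hbn : ‖(b : ℚ_[5])‖ = 1 := norm_intCast_eq_one_of_not_dvd h5b
  have hb0 : (b : ℚ_[5]) ≠ 0 := by intro h; rw [h, norm_zero] at hbn; exact zero_ne_one hbn
  have hen : ‖((e' : ℤ) : ℚ_[5])‖ = 1 := norm_intCast_eq_one_of_not_dvd h5e
  have he0 : ((e' : ℤ) : ℚ_[5]) ≠ 0 := by intro h; rw [h, norm_zero] at hen; exact zero_ne_one hen
  have he0' : (e' : ℚ_[5]) ≠ 0 := by exact_mod_cast he0
  have hae : ‖((-a * e' : ℤ) : ℚ_[5])‖ = 1 := by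
    rw [Int.cast_mul, norm_mul, Int.cast_neg, norm_neg, norm_intCast_eq_one_of_not_dvd h5a, hen, one_mul]
  have hzval : z = 5 * ((-a * e' : ℤ) : ℚ_[5]) / (b : ℚ_[5]) := by
    have h50 : (5 : ℚ_[5]) ≠ 0 := by norm_num
    rw [hz, hx, hy]; push_cast; field_simp
  have hzn : ‖z‖ = 1 / 5 := by rw [hzval, norm_div, norm_mul, norm_five₄, hae, hbn]; norm_num
  have hFL := norm_padicFormalLog_sub_quadratic_le_depthOne V hzn.le
  rw [ha1] at hFL
  have hres : ‖(z + (2 : ℚ_[5])⁻¹ * (a₁ : ℚ_[5]) * z ^ 2) - 5 * (lam : ℚ_[5])‖ ≤ 1 / 5 ^ 3 := by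
    have hid : (z + (2 : ℚ_[5])⁻¹ * (a₁ : ℚ_[5]) * z ^ 2) - 5 * (lam : ℚ_[5]) =
        5 * (((-2 * a * e' * b + 5 * a₁ * a ^ 2 * e' ^ 2 - 2 * lam * b ^ 2 : ℤ)) : ℚ_[5]) /
          ((2 * b ^ 2 : ℤ) : ℚ_[5]) := by
      have h20 : (2 : ℚ_[5]) ≠ 0 := by norm_num
      rw [hzval]; push_cast; field_simp
    rw [hid, norm_div, norm_mul, norm_five₄]
    have hK : ‖(((-2 * a * e' * b + 5 * a₁ * a ^ 2 * e' ^ 2 - 2 * lam * b ^ 2 : ℤ)) : ℚ_[5])‖ ≤ 1 / 25 := by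
      refine ((Padic.norm_int_le_pow_iff_dvd (p := 5) _ 2).mpr (by exact_mod_cast hlam)).trans ?_
      norm_num
    have hD : ‖((2 * b ^ 2 : ℤ) : ℚ_[5])‖ = 1 :=
      norm_intCast_eq_one_of_not_dvd (by
        intro h
        have h2 : (5 : ℤ) ∣ b ^ 2 :=
          ((Int.prime_iff_natAbs_prime.mpr (by norm_num) : Prime (5 : ℤ)).dvd_or_dvd h).resolve_left (by norm_num)
        exact not_five_dvd_sq h5b h2)
    rw [hD, div_one]
    calc 1 / 5 * ‖(((-2 * a * e' * b + 5 * a₁ * a ^ 2 * e' ^ 2 - 2 * lam * b ^ 2 : ℤ)) : ℚ_[5])‖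
        ≤ 1 / 5 * (1 / 25) := by gcongr
      _ = 1 / 5 ^ 3 := by norm_num
  have hL : ‖V.padicFormalLog z - 5 * (lam : ℚ_[5])‖ ≤ 1 / 5 ^ 3 := by
    have : V.padicFormalLog z - 5 * (lam : ℚ_[5]) = (V.padicFormalLog z - (z + (2 : ℚ_[5])⁻¹ * (a₁ : ℚ_[5]) * z ^ 2)) +
        ((z + (2 : ℚ_[5])⁻¹ * (a₁ : ℚ_[5]) * z ^ 2) - 5 * (lam : ℚ_[5])) := by ring
    rw [this]
    exact (IsUltrametricDist.norm_add_le_max _ _).trans (max_le hFL hres)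
  have hlamn : ‖(lam : ℚ_[5])‖ = 1 := norm_intCast_eq_one_of_not_dvd h5lam
  have h5lamn : ‖(5 * (lam : ℚ_[5]))‖ = 1 / 5 := by rw [norm_mul, norm_five₄, hlamn, mul_one]
  have hLn : ‖V.padicFormalLog z‖ = 1 / 5 := by
    have hlt : ‖V.padicFormalLog z - 5 * (lam : ℚ_[5])‖ < ‖(5 * (lam : ℚ_[5]))‖ := by
      rw [h5lamn]; exact hL.trans_lt (by norm_num)
    rw [Padic.norm_eq_of_norm_sub_lt_right hlt, h5lamn]
  set L := V.padicFormalLog z with hLdef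
  set C2 := uniformisationScaleSq W 5 q with hC2def
  have hC2 : ‖C2‖ = 1 := norm_uniformisationScaleSq_eq_one_of_units W hW hc4 hc6 h5c4 h5c6 hq
  have hC20 : C2 ≠ 0 := uniformisationScaleSq_ne_zero_of_units W hW hc4 hc6 h5c4 h5c6 hq
  have hwdef : logUnitParamSq W 5 q x y = L ^ 2 / C2 := by rw [logUnitParamSq]
  set w := logUnitParamSq W 5 q x y with hw
  have hwn : ‖w‖ ≤ 1 / 25 := by rw [hwdef, norm_div, norm_pow, hLn, hC2]; norm_num
  have hS := norm_tateSigmaSq_coshOfSq_sub_le_depthOne hq hwn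
  set S2 := tateSigmaSq q (coshOfSq w) with hS2
  have hCw : C2 * w = L ^ 2 := by rw [hwdef]; field_simp
  have hB1 : ‖C2 * S2 - L ^ 2‖ ≤ 1 / 5 ^ 4 := by
    rw [← hCw, ← mul_sub, norm_mul, hC2, one_mul]; exact hS
  have hB2 : ‖L ^ 2 - 25 * (lam : ℚ_[5]) ^ 2‖ ≤ 1 / 5 ^ 4 := by
    rw [show (25 : ℚ_[5]) * (lam : ℚ_[5]) ^ 2 = (5 * (lam : ℚ_[5])) ^ 2 by ring, sq_sub_sq, norm_mul]
    have hplus : ‖L + 5 * (lam : ℚ_[5])‖ ≤ 1 / 5 :=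
      (IsUltrametricDist.norm_add_le_max _ _).trans (max_le hLn.le h5lamn.le)
    calc ‖L + 5 * (lam : ℚ_[5])‖ * ‖L - 5 * (lam : ℚ_[5])‖ ≤ 1 / 5 * (1 / 5 ^ 3) := by gcongr
      _ = 1 / 5 ^ 4 := by norm_num
  have hB : ‖C2 * S2 - 25 * (lam : ℚ_[5]) ^ 2‖ ≤ 1 / 5 ^ 4 := by
    have hid : C2 * S2 - 25 * (lam : ℚ_[5]) ^ 2 = (C2 * S2 - L ^ 2) + (L ^ 2 - 25 * (lam : ℚ_[5]) ^ 2) := by ring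
    rw [hid]
    exact (IsUltrametricDist.norm_add_le_max _ _).trans (max_le hB1 hB2)
  exact ⟨hLn, hB2, hC2, hB, den_eq_sq₄ (by positivity) hcop hx⟩

end Data

/-! ### §2 The VALUE of the formula-(4.1) height to one digit: `‖T₁ − 5τ₁‖₅ ≤ 5⁻²` -/

section Value

variable (W : WeierstrassCurve ℚ) {a₁ a₂ a₃ a₄ a₆ : ℤ} (hW : W = ⟨a₁, a₂, a₃, a₄, a₆⟩)
include hW

/-- **`T₁ = heightFourOneCoord ≡ 5τ₁ (mod 5⁻²)` at a depth-one certificate point.** With the data of §1: `T₁ = log₅(25e'²) − log₅(C²σ²)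
= −log₅ U`, `U = C²σ²/(25e'²) = (λ/e')²·(1 + O(5⁻²))`, `log₅ U = 4⁻¹(U⁴ − 1) + O(‖1 − U⁴‖²)` (`KernelCertFive.norm_padicLog_unit_sub_le`),
so `T₁ = −(λ⁸ − e'⁸)/(4e'⁸) + O(5⁻²)`, and the integer `τ₁` with `25 ∣ (λ⁸ − e'⁸) + 20e'⁸τ₁` is its first digit: `‖T₁ − 5τ₁‖₅ ≤ 5⁻²`
(`τ₁ ≡ 0` allowed: then `v₅(T₁) ≥ 2`). [cite: SteinWuthrich2013, §4.2] [cite: Iwasawa1972PadicL, §4.4] -/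
theorem norm_heightFourOneCoord_sub_le_depthOne [W.IsGloballyMinimal] {a b c4 c6 lam τ₁ : ℤ} {e' : ℕ}
    (hc4 : c4 = (a₁ ^ 2 + 4 * a₂) ^ 2 - 24 * (2 * a₄ + a₁ * a₃))
    (hc6 : c6 = -(a₁ ^ 2 + 4 * a₂) ^ 3 + 36 * (a₁ ^ 2 + 4 * a₂) * (2 * a₄ + a₁ * a₃) - 216 * (a₃ ^ 2 + 4 * a₆))
    (h5c4 : ¬ (5 : ℤ) ∣ c4) (h5c6 : ¬ (5 : ℤ) ∣ c6) (h5e : ¬ (5 : ℤ) ∣ e') (h5b : ¬ (5 : ℤ) ∣ b)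
    (hcop : Nat.Coprime a.natAbs (5 * e'))
    {x y : ℚ} (hx : x = a / ((5 * e' : ℕ) : ℚ) ^ 2) (hy : y = b / ((5 * e' : ℕ) : ℚ) ^ 3)
    (hlam : (25 : ℤ) ∣ -2 * a * e' * b + 5 * a₁ * a ^ 2 * e' ^ 2 - 2 * lam * b ^ 2) (h5lam : ¬ (5 : ℤ) ∣ lam)
    (hτ₁ : (25 : ℤ) ∣ (lam ^ 8 - (e' : ℤ) ^ 8) + 20 * (e' : ℤ) ^ 8 * τ₁)
    {q : ℚ_[5]} (hq : ‖q‖ < 1) :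
    ‖heightFourOneCoord W 5 q x y - 5 * (τ₁ : ℚ_[5])‖ ≤ 1 / 25 := by
  obtain ⟨hLn, hL2, hC2, hB, hden⟩ := firstOrderData_depthOne W hW hc4 hc6 h5c4 h5c6 h5e h5b hcop hx hy hlam h5lam hq
  set C2 := uniformisationScaleSq W 5 q with hC2def
  set S2 := tateSigmaSq q (coshOfSq (logUnitParamSq W 5 q x y)) with hS2def
  have hlamn : ‖(lam : ℚ_[5])‖ = 1 := norm_intCast_eq_one_of_not_dvd h5lam
  have hen : ‖((e' : ℤ) : ℚ_[5])‖ = 1 := norm_intCast_eq_one_of_not_dvd h5e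
  have he0 : (e' : ℚ_[5]) ≠ 0 := by
    have : ((e' : ℤ) : ℚ_[5]) ≠ 0 := by intro h; rw [h, norm_zero] at hen; exact zero_ne_one hen
    exact_mod_cast this
  have hen' : ‖(e' : ℚ_[5])‖ = 1 := by exact_mod_cast hen
  -- `A = den x = 25e'²`, `B = C²σ²`, both of norm `5⁻²`
  set A : ℚ_[5] := (((x.den : ℚ)) : ℚ_[5]) with hAdef
  have hA : A = 25 * (e' : ℚ_[5]) ^ 2 := by rw [hAdef, hden]; push_cast; ring
  have hAn : ‖A‖ = 1 / 25 := by rw [hA, norm_mul, norm_twentyfive₄, norm_pow, hen']; norm_num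
  have hA0 : A ≠ 0 := by intro h; rw [h, norm_zero] at hAn; norm_num at hAn
  have h25lam : ‖(25 : ℚ_[5]) * (lam : ℚ_[5]) ^ 2‖ = 1 / 25 := by rw [norm_mul, norm_twentyfive₄, norm_pow, hlamn]; norm_num
  have hBn : ‖C2 * S2‖ = 1 / 25 := by
    have hlt : ‖C2 * S2 - 25 * (lam : ℚ_[5]) ^ 2‖ < ‖(25 : ℚ_[5]) * (lam : ℚ_[5]) ^ 2‖ := by
      rw [h25lam]; exact hB.trans_lt (by norm_num)
    rw [Padic.norm_eq_of_norm_sub_lt_right hlt, h25lam]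
  have hB0 : C2 * S2 ≠ 0 := by intro h; rw [h, norm_zero] at hBn; norm_num at hBn
  -- `U = B/A`, a unit within `5⁻²` of `U₀ = (λ/e')²`
  set U : ℚ_[5] := C2 * S2 / A with hUdef
  set U₀ : ℚ_[5] := ((lam : ℚ_[5]) / (e' : ℚ_[5])) ^ 2 with hU₀def
  have hUn : ‖U‖ = 1 := by rw [hUdef, norm_div, hBn, hAn]; norm_num
  have hU₀n : ‖U₀‖ = 1 := by rw [hU₀def, norm_pow, norm_div, hlamn, hen']; norm_num
  have hUU₀ : ‖U - U₀‖ ≤ 1 / 25 := by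
    have hid : U - U₀ = (C2 * S2 - 25 * (lam : ℚ_[5]) ^ 2) / A := by
      rw [hUdef, hU₀def, hA]; field_simp
    rw [hid, norm_div, hAn]
    calc ‖C2 * S2 - 25 * (lam : ℚ_[5]) ^ 2‖ / (1 / 25) ≤ (1 / 5 ^ 4) / (1 / 25) := by gcongr
      _ = 1 / 25 := by norm_num
  have hU4 : ‖U ^ 4 - U₀ ^ 4‖ ≤ 1 / 25 := (norm_pow_four_sub_le₄ hUn.le hU₀n.le).trans hUU₀
  -- `1 − U₀⁴ = (e'⁸ − λ⁸)/e'⁸` has norm `≤ 5⁻¹`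
  have h5d : (5 : ℤ) ∣ lam ^ 8 - (e' : ℤ) ^ 8 := by
    have h25 : (5 : ℤ) ∣ (lam ^ 8 - (e' : ℤ) ^ 8) + 20 * (e' : ℤ) ^ 8 * τ₁ := (dvd_trans (by norm_num) hτ₁)
    have h20 : (5 : ℤ) ∣ 20 * (e' : ℤ) ^ 8 * τ₁ := dvd_mul_of_dvd_left (dvd_mul_of_dvd_left (by norm_num) _) _
    simpa using (Int.dvd_sub h25 h20)
  have hU₀4 : 1 - U₀ ^ 4 = -((((lam ^ 8 - (e' : ℤ) ^ 8 : ℤ)) : ℚ_[5]) / (e' : ℚ_[5]) ^ 8) := by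
    rw [hU₀def]; push_cast; field_simp; ring
  have h1U₀ : ‖1 - U₀ ^ 4‖ ≤ 1 / 5 := by
    rw [hU₀4, norm_neg, norm_div, norm_pow, hen', one_pow, div_one]
    refine ((Padic.norm_int_le_pow_iff_dvd (p := 5) _ 1).mpr (by simpa using h5d)).trans (by norm_num)
  have h1U : ‖1 - U ^ 4‖ ≤ 1 / 5 := by
    have : 1 - U ^ 4 = (1 - U₀ ^ 4) - (U ^ 4 - U₀ ^ 4) := by ring
    rw [this]; exact (norm_sub_le_max₄ _ _).trans (max_le h1U₀ (hU4.trans (by norm_num)))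
  -- `log₅ U = 4⁻¹(U⁴ − 1) + O(5⁻²)`
  have hlog := norm_padicLog_unit_sub_le hUn
  have hlog' : ‖padicLog 5 U - (4 : ℚ_[5])⁻¹ * (U ^ 4 - 1)‖ ≤ 1 / 25 :=
    hlog.trans (by calc ‖1 - U ^ 4‖ ^ 2 ≤ (1 / 5) ^ 2 := by gcongr
                    _ = 1 / 25 := by norm_num)
  -- `T₁ = log A − log B = −log U`
  have hT : heightFourOneCoord W 5 q x y = -padicLog 5 U := by
    rw [heightFourOneCoord, hUdef]; exact padicLog_sub_eq_neg_padicLog_div hA0 hB0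
  -- the residue
  have hres : ‖-(4 : ℚ_[5])⁻¹ * (U₀ ^ 4 - 1) - 5 * (τ₁ : ℚ_[5])‖ ≤ 1 / 25 := by
    have hid : -(4 : ℚ_[5])⁻¹ * (U₀ ^ 4 - 1) - 5 * (τ₁ : ℚ_[5]) =
        -((4 : ℚ_[5])⁻¹ * (((((lam ^ 8 - (e' : ℤ) ^ 8) + 20 * (e' : ℤ) ^ 8 * τ₁ : ℤ)) : ℚ_[5]) / (e' : ℚ_[5]) ^ 8)) := by
      have h40 : (4 : ℚ_[5]) ≠ 0 := by norm_num
      rw [hU₀def]; push_cast; field_simp; ring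
    rw [hid, norm_neg, norm_mul, norm_inv_four₄, one_mul, norm_div, norm_pow, hen', one_pow, div_one]
    refine ((Padic.norm_int_le_pow_iff_dvd (p := 5) _ 2).mpr (by exact_mod_cast hτ₁)).trans (by norm_num)
  have hid : heightFourOneCoord W 5 q x y - 5 * (τ₁ : ℚ_[5]) =
      -(padicLog 5 U - (4 : ℚ_[5])⁻¹ * (U ^ 4 - 1)) + (-((4 : ℚ_[5])⁻¹ * (U ^ 4 - U₀ ^ 4))) +
        (-(4 : ℚ_[5])⁻¹ * (U₀ ^ 4 - 1) - 5 * (τ₁ : ℚ_[5])) := by rw [hT]; ring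
  rw [hid]
  refine (IsUltrametricDist.norm_add_le_max _ _).trans (max_le ?_ hres)
  refine (IsUltrametricDist.norm_add_le_max _ _).trans (max_le ?_ ?_)
  · rw [norm_neg]; exact hlog'
  · rw [norm_neg, norm_mul, norm_inv_four₄, one_mul]; exact hU4

end Value

end Summit.BirchSwinnertonDyer.Rank1Residual.X11b.RegMult.KernelCertFive
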